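/-
Copyright (c) 2026 the pub-hodgecm-mathlib formalisation cell (harness21).  Prover seat hodgecm-mathlib-K2Liu-p11 (g2), Track B «K2-LIT»,
#184♮ = hLiu418 = `stmt-HodgeConjecture-24832`; A7-val road (σ) «null-cone multiplicity one» (K2Liu-p09 (g6) memo §3 V2, (q3) 11:27:21Z:
«(N″) is needed, in EXTENSION form (V2c)»), LEAD F0P6-plan (g14) RULING «M-158d» (1) «V2 = K2Liu-p11 (g2)»; file V2c.
THEOREMS ONLY (no `def`, no `instance`, no notation, no named-fact hypothesis, no `sorry`).
-/
import Literature.NumberTheory.Automorphic.LocalPiModulationInvariantFunctional   -- ★ `SchwartzBruhat`, `piPrimePowBall` boxes and their translates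
import Summits.HodgeConjecture.HodgeConjecture.Theorems.F0P2oLocallyConstantCoboundary  -- ★ `isLocallyConstant_indicator_const`
import HarnessLib

/-!
# Crux `HLiu418`, A7-val (σ), V2c: restriction of test functions to a (locally closed) subset is ONTO — the extension operator
# `C_c^∞(Z) → 𝒮(X)` of a t.d. space, with prescribed open support

Cell `hodgecm-mathlib`, crux item hLiu418 = `stmt-HodgeConjecture-24832` (helper lane `--supports`, count-neutral).

K2Liu-p09 (g6) (q3): «for `𝒩 ⊆ X` closed, every locally constant compactly supported `f` on the subtype `𝒩` is `Φ|_𝒩` for some `Φ ∈ 𝒮(X)`,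
and `Φ` may be taken supported inside any given open `U ⊇ supp f` (V5 uses `U = X ∖ {0}` to stay in `𝒮₁ = {0 ∉ supp}`)».  Typed GENERICALLY
for a topological space `X` with a basis of compact open sets and Hausdorff (§3), and SPECIALISED to `X = F^ι`, `F` a non-archimedean local
field (§4, no extra hypotheses: the translated boxes `a + (𝔭^N)^ι` are the basis); closedness of `Z` is NOT needed for the extension (only
for the restriction to have compact support, §4).
* §1 letters: finite sums of locally constant functions; a locally constant compactly supported function has finite range
  (indicators of clopen sets: ★ `F0P2oLocallyConstantCoboundary.isLocallyConstant_indicator_const`);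
* §2 `exists_isCompact_isOpen_preimage_val_eq` — a compact open subset `A` of a subspace `Z ⊆ X` is cut out by a compact open `V ⊆ U` of `X`;
* §3 **`exists_extension`** — `f : Z → ℂ` locally constant, compactly supported, `U ⊆ X` open containing `supp f` ⇒
  `∃ Φ`, locally constant, compactly supported, `supp Φ ⊆ U`, `Φ|_Z = f`; and `exists_schwartzBruhat_extension` (`Φ ∈ 𝒮(X)`);
* §4 `X = F^ι`: `isTopologicalBasis_isCompact_isOpen_pi`, **`exists_extension_pi`**, `exists_schwartzBruhat_extension_pi`; restriction INTO
  `𝒮(Z)`: `comp_val_mem_schwartzBruhat` (`Z` closed), `comp_val_mem_schwartzBruhat_inter` (`Z = C ∩ U`, `C` closed, `U ⊇ supp Φ` open);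
* §5 **`exists_descend`** — a linear `T : (X → ℂ) →ₗ[ℂ] ℂ` whose value on `U`-supported elements of `𝒮(X)` depends only on the restriction
  to `C ∩ U` DESCENDS to a linear `T′ : 𝒮(C ∩ U) →ₗ[ℂ] ℂ` with `T′ (Φ|_{C ∩ U}) = T Φ` (V5: `C = 𝒩`, `U = {x ≠ 0}`, `C ∩ U = 𝒩₁`).
References: [BernsteinZelevinsky1976, §1.1–1.8 (Prop. 1.8: `0 → 𝒮(U) → 𝒮(X) → 𝒮(Z) → 0`)]; [WeilBNT1967, Ch. II §5].
HONEST LABEL: HC_CM is proved only modulo the 7 printed citations (2 remaining named inputs: hLiu418 = stmt-HodgeConjecture-24832,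
h413 = stmt-HodgeConjecture-24833) until rung 0 closes; count-neutral helper, closes no socket.
-/

set_option autoImplicit false
set_option linter.dupNamespace false

noncomputable section

open Set Filter TopologicalSpace
open scoped Topology Pointwise

namespace Summit.HodgeConjecture.HodgeConjecture.Cruxes.HLiu418.K2LiuTDRestrictionOnto

open Literature.NumberTheory.Automorphic
open Summit.HodgeConjecture.HodgeConjecture.Cruxes.H413.F0P2oLocallyConstantCoboundary (isLocallyConstant_indicator_const)

variable {X : Type*} [TopologicalSpace X]

/-! ## §1  Letters -/

/-- A finite sum of locally constant functions is locally constant. [BernsteinZelevinsky1976, §1.1] -/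
theorem isLocallyConstant_finset_sum {α : Type*} (s : Finset α) {g : α → X → ℂ} (hg : ∀ a ∈ s, IsLocallyConstant (g a)) :
    IsLocallyConstant fun x => ∑ a ∈ s, g a x := by
  classical
  induction s using Finset.induction_on with
  | empty =>
    simp only [Finset.sum_empty]
    exact IsLocallyConstant.const (0 : ℂ)
  | insert a s ha ih =>
    have h : (fun x => ∑ b ∈ insert a s, g b x) = fun x => g a x + ∑ b ∈ s, g b x := by
      funext x
      rw [Finset.sum_insert ha]
    rw [h]
    exact (hg a (Finset.mem_insert_self a s)).add (ih fun b hb => hg b (Finset.mem_insert_of_mem hb))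

/-- A locally constant compactly supported function has FINITE RANGE. [BernsteinZelevinsky1976, §1.1] -/
theorem range_finite_of_hasCompactSupport {Z : Type*} [TopologicalSpace Z] {f : Z → ℂ} (hfl : IsLocallyConstant f)
    (hfc : HasCompactSupport f) : (Set.range f).Finite := by
  haveI : CompactSpace (tsupport f) := isCompact_iff_compactSpace.mp hfc.isCompact
  have hfin : (Set.range (f ∘ ((↑) : tsupport f → Z))).Finite := (hfl.comp_continuous continuous_subtype_val).range_finite
  refine (hfin.insert 0).subset ?_
  rintro _ ⟨z, rfl⟩
  by_cases hz : z ∈ tsupport f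
  · exact mem_insert_of_mem _ ⟨⟨z, hz⟩, rfl⟩
  · exact mem_insert_iff.2 (Or.inl (image_eq_zero_of_notMem_tsupport hz))

/-! ## §2  Compact open subsets of a subspace are cut out by compact open subsets of the space -/

/-- **CUTTING OUT.**  `X` with a basis of compact open sets, `Z ⊆ X` any subset (subspace topology), `A ⊆ Z` open in `Z` and compact,
`U ⊆ X` open with `A ⊆ U`: there is a compact open `V ⊆ U` of `X` with `V ∩ Z = A`. [BernsteinZelevinsky1976, §1.1–1.3] -/
theorem exists_isCompact_isOpen_preimage_val_eq (hB : IsTopologicalBasis {s : Set X | IsCompact s ∧ IsOpen s}) {Z : Set X}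
    {A : Set Z} (hAo : IsOpen A) (hAc : IsCompact A) {U : Set X} (hU : IsOpen U) (hAU : ∀ z ∈ A, (z : X) ∈ U) :
    ∃ V : Set X, IsCompact V ∧ IsOpen V ∧ V ⊆ U ∧ ((↑) : Z → X) ⁻¹' V = A := by
  obtain ⟨W, hWo, hWA⟩ := isOpen_induced_iff.mp hAo
  -- a compact open `V z ⊆ W ∩ U` through every point of `A`
  have hV : ∀ z : Z, z ∈ A → ∃ V ∈ {s : Set X | IsCompact s ∧ IsOpen s}, (z : X) ∈ V ∧ V ⊆ W ∩ U := fun z hz =>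
    hB.exists_subset_of_mem_open (by rw [← hWA] at hz; exact ⟨hz, hAU z (hWA ▸ hz)⟩) (hWo.inter hU)
  choose! V hVmem hzV hVsub using hV
  obtain ⟨t, htA, ht⟩ : ∃ t : Finset Z, ↑t ⊆ A ∧ A ⊆ ⋃ z ∈ t, ((↑) : Z → X) ⁻¹' V z := by
    obtain ⟨t, ht⟩ := hAc.elim_finite_subcover_image (b := A) (c := fun z => ((↑) : Z → X) ⁻¹' V z)
      (fun z hz => (hVmem z hz).2.preimage continuous_subtype_val) fun z hz => mem_iUnion₂.2 ⟨z, hz, hzV z hz⟩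
    classical
    exact ⟨ht.2.1.toFinset, by simpa using ht.1, by simpa using ht.2.2⟩
  refine ⟨⋃ z ∈ t, V z, t.isCompact_biUnion fun z hz => (hVmem z (htA hz)).1,
    isOpen_biUnion fun z hz => (hVmem z (htA hz)).2, iUnion₂_subset fun z hz => (hVsub z (htA hz)).trans inter_subset_right, ?_⟩
  refine Subset.antisymm (fun z hz => ?_) fun z hz => by simpa only [preimage_iUnion] using ht hz
  rw [preimage_iUnion₂, mem_iUnion₂] at hz
  obtain ⟨z', hz', hzz'⟩ := hz
  have h : (z : X) ∈ W := ((hVsub z' (htA hz')) hzz').1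
  rw [← hWA]
  exact h

/-! ## §3  The extension operator (generic) -/

/-- **EXTENSION WITH PRESCRIBED OPEN SUPPORT (generic).**  `X` Hausdorff with a basis of compact open sets, `Z ⊆ X` ANY subset,
`f : Z → ℂ` locally constant and compactly supported (on the subspace `Z`), `U ⊆ X` open containing `supp f`.  Then there is
`Φ : X → ℂ` locally constant, compactly supported, with `supp Φ ⊆ U` and `Φ|_Z = f`. [BernsteinZelevinsky1976, §1.3, Prop. 1.8] -/
theorem exists_extension [T2Space X] (hB : IsTopologicalBasis {s : Set X | IsCompact s ∧ IsOpen s}) {Z : Set X} (f : Z → ℂ)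
    (hfl : IsLocallyConstant f) (hfc : HasCompactSupport f) {U : Set X} (hU : IsOpen U) (hfU : ∀ z : Z, f z ≠ 0 → (z : X) ∈ U) :
    ∃ Φ : X → ℂ, IsLocallyConstant Φ ∧ HasCompactSupport Φ ∧ (∀ x, Φ x ≠ 0 → x ∈ U) ∧ ∀ z : Z, Φ z = f z := by
  classical
  -- the non-zero fibres `A c = {f = c ≠ 0}`: open and compact in `Z`, inside `U`
  set A : ℂ → Set Z := fun c => f ⁻¹' {w | w = c ∧ w ≠ 0} with hA
  have hAo : ∀ c, IsOpen (A c) := fun c => hfl _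
  have hAcl : ∀ c, IsClosed (A c) := fun c => ⟨hfl {w | w = c ∧ w ≠ 0}ᶜ⟩
  have hAc : ∀ c, IsCompact (A c) := fun c =>
    hfc.isCompact.of_isClosed_subset (hAcl c) fun z hz => subset_tsupport _ (by exact hz.2)
  have hAU : ∀ c, ∀ z ∈ A c, (z : X) ∈ U := fun c z hz => hfU z hz.2
  choose V hVc hVo hVU hVA using fun c => exists_isCompact_isOpen_preimage_val_eq hB (hAo c) (hAc c) hU (hAU c)
  -- the finitely many values
  set S : Finset ℂ := (range_finite_of_hasCompactSupport hfl hfc).toFinset with hS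
  refine ⟨fun x => ∑ c ∈ S, (V c).indicator (fun _ => c) x, ?_, ?_, ?_, ?_⟩
  · exact isLocallyConstant_finset_sum S fun c _ => isLocallyConstant_indicator_const ⟨(hVc c).isClosed, hVo c⟩ c
  · refine HasCompactSupport.intro' (S.isCompact_biUnion fun c _ => hVc c) (isClosed_biUnion_finset fun c _ => (hVc c).isClosed)
      fun x hx => Finset.sum_eq_zero fun c hc => ?_
    rw [mem_iUnion₂] at hx
    exact indicator_of_notMem (fun h => hx ⟨c, hc, h⟩) _
  · intro x hx
    obtain ⟨c, -, hc⟩ := Finset.exists_ne_zero_of_sum_ne_zero hx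
    exact hVU c (mem_of_indicator_ne_zero hc)
  · intro z
    have hmem : ∀ c, ((z : X) ∈ V c) ↔ (f z = c ∧ f z ≠ 0) := fun c => by
      rw [← mem_preimage, hVA c]
      rfl
    by_cases hz : f z = 0
    · rw [hz]
      exact Finset.sum_eq_zero fun c _ => indicator_of_notMem (fun h => ((hmem c).1 h).2 hz) _
    · have hzS : f z ∈ S := by
        rw [hS, Finite.mem_toFinset]
        exact mem_range_self z
      calc ∑ c ∈ S, (V c).indicator (fun _ => c) (z : X) = ∑ c ∈ S, (if f z = c then c else 0) :=
            Finset.sum_congr rfl fun c _ => by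
              by_cases h : f z = c
              · rw [if_pos h, indicator_of_mem ((hmem c).2 ⟨h, hz⟩)]
              · rw [if_neg h, indicator_of_notMem (fun h' => h ((hmem c).1 h').1)]
        _ = f z := by
            rw [Finset.sum_ite_eq]
            exact if_pos hzS

/-- The same, landing in `𝒮(X)`: `∃ Φ ∈ SchwartzBruhat X`, `supp Φ ⊆ U`, `Φ|_Z = f`. [BernsteinZelevinsky1976, §1.3, Prop. 1.8] -/
theorem exists_schwartzBruhat_extension [T2Space X] (hB : IsTopologicalBasis {s : Set X | IsCompact s ∧ IsOpen s}) {Z : Set X}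
    (f : Z → ℂ) (hfl : IsLocallyConstant f) (hfc : HasCompactSupport f) {U : Set X} (hU : IsOpen U)
    (hfU : ∀ z : Z, f z ≠ 0 → (z : X) ∈ U) :
    ∃ Φ ∈ SchwartzBruhat X, (∀ x, Φ x ≠ 0 → x ∈ U) ∧ ∀ z : Z, Φ z = f z := by
  obtain ⟨Φ, hl, hc, hU', hZ⟩ := exists_extension hB f hfl hfc hU hfU
  exact ⟨Φ, ⟨hl, hc⟩, hU', hZ⟩

/-- RESTRICTION lands in `𝒮(Z)` for `Z` CLOSED: `Φ ∈ 𝒮(X) ⇒ Φ|_Z ∈ 𝒮(Z)`. [BernsteinZelevinsky1976, §1.3, Prop. 1.8] -/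
theorem comp_val_mem_schwartzBruhat {Z : Set X} (hZ : IsClosed Z) {Φ : X → ℂ} (hΦ : Φ ∈ SchwartzBruhat X) :
    (Φ ∘ ((↑) : Z → X)) ∈ SchwartzBruhat Z :=
  ⟨hΦ.1.comp_continuous continuous_subtype_val, hΦ.2.comp_isClosedEmbedding hZ.isClosedEmbedding_subtypeVal⟩

/-- RESTRICTION to a LOCALLY CLOSED `Z = C ∩ U` (`C` closed, `U` open) lands in `𝒮(C ∩ U)` for `Φ ∈ 𝒮(X)` SUPPORTED IN `U`
(V5: `C = 𝒩`, `U = {x ≠ 0}`, `𝒮₁ → C_c^∞(𝒩₁)`). [BernsteinZelevinsky1976, §1.3, Prop. 1.8] -/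
theorem comp_val_mem_schwartzBruhat_inter {C U : Set X} (hC : IsClosed C) {Φ : X → ℂ} (hΦ : Φ ∈ SchwartzBruhat X)
    (hΦU : ∀ x, Φ x ≠ 0 → x ∈ U) : (Φ ∘ ((↑) : ↥(C ∩ U) → X)) ∈ SchwartzBruhat ↥(C ∩ U) := by
  refine ⟨hΦ.1.comp_continuous continuous_subtype_val, ?_⟩
  -- the support of `Φ` is closed (locally constant), compact, and inside `U`; its trace on `C` is compact and lies in `C ∩ U`
  have hsupp : IsClosed {x | Φ x ≠ 0} := by
    have h : {x : X | Φ x ≠ 0} = {x | Φ x = 0}ᶜ := by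
      ext x
      simp
    rw [h]
    exact (hΦ.1.isOpen_fiber 0).isClosed_compl
  have hK : IsCompact (C ∩ {x | Φ x ≠ 0}) :=
    (hΦ.2.isCompact.of_isClosed_subset hsupp fun x hx => subset_tsupport _ hx).inter_left hC
  -- pull back to the subtype `C ∩ U`
  have hKsub : C ∩ {x | Φ x ≠ 0} ⊆ C ∩ U := fun x hx => ⟨hx.1, hΦU x hx.2⟩
  have hK' : IsCompact (((↑) : ↥(C ∩ U) → X) ⁻¹' (C ∩ {x | Φ x ≠ 0})) :=
    Topology.IsInducing.subtypeVal.isCompact_preimage' hK (by rwa [Subtype.range_coe])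
  refine HasCompactSupport.intro' hK' ((hC.inter hsupp).preimage continuous_subtype_val) fun z hz => ?_
  by_contra h
  exact hz ⟨z.2.1, h⟩

/-! ## §4  `X = F^ι`, `F` a non-archimedean local field -/

section Pi

variable {F : Type*} [Field F] [ValuativeRel F] [TopologicalSpace F] [IsNonarchimedeanLocalField F]
variable {ι : Type*} [Fintype ι]

/-- **`F^ι` HAS A BASIS OF COMPACT OPEN SETS** — the translated boxes `a + (𝔭^N)^ι`. [WeilBNT1967, Ch. II §5] -/
theorem isTopologicalBasis_isCompact_isOpen_pi : IsTopologicalBasis {s : Set (ι → F) | IsCompact s ∧ IsOpen s} := by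
  refine isTopologicalBasis_of_isOpen_of_nhds (fun u hu => hu.2) fun a u hau hu => ?_
  have h : (fun t => a + t) ⁻¹' u ∈ 𝓝 (0 : ι → F) :=
    (continuous_const.add continuous_id).continuousAt.preimage_mem_nhds (by simpa using hu.mem_nhds hau)
  obtain ⟨N, hN⟩ := exists_piPrimePowBall_subset_of_mem_nhds_zero h
  refine ⟨a +ᵥ piPrimePowBall F ι (N : ℤ), ⟨isCompact_vadd_piPrimePowBall _ a, isOpen_vadd_piPrimePowBall _ a⟩,
    self_mem_vadd_piPrimePowBall _ a, fun x hx => ?_⟩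
  obtain ⟨t, ht, rfl⟩ := mem_vadd_set.1 hx
  exact hN ht

omit [Fintype ι] in
/-- `F^ι` is Hausdorff (valuative topologies are). [WeilBNT1967, Ch. I §3] -/
theorem t2Space_pi : T2Space (ι → F) := by
  haveI : T2Space F := (Literature.NumberTheory.GaloisRepresentations.IsNonarchimedeanLocalField.isLocalField F).toT2Space
  infer_instance

/-- **EXTENSION WITH PRESCRIBED OPEN SUPPORT ON `F^ι`.**  `Z ⊆ F^ι` any subset, `f : Z → ℂ` locally constant compactly supported,
`U` open containing `supp f` ⇒ `∃ Φ : F^ι → ℂ` locally constant, compactly supported, `supp Φ ⊆ U`, `Φ|_Z = f`.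
[BernsteinZelevinsky1976, §1.3, Prop. 1.8] -/
theorem exists_extension_pi {Z : Set (ι → F)} (f : Z → ℂ) (hfl : IsLocallyConstant f) (hfc : HasCompactSupport f)
    {U : Set (ι → F)} (hU : IsOpen U) (hfU : ∀ z : Z, f z ≠ 0 → (z : ι → F) ∈ U) :
    ∃ Φ : (ι → F) → ℂ, IsLocallyConstant Φ ∧ HasCompactSupport Φ ∧ (∀ x, Φ x ≠ 0 → x ∈ U) ∧ ∀ z : Z, Φ z = f z := by
  haveI := t2Space_pi (F := F) (ι := ι)
  exact exists_extension isTopologicalBasis_isCompact_isOpen_pi f hfl hfc hU hfU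

/-- The same, landing in `𝒮(F^ι)`. [BernsteinZelevinsky1976, §1.3, Prop. 1.8] -/
theorem exists_schwartzBruhat_extension_pi {Z : Set (ι → F)} (f : Z → ℂ) (hfl : IsLocallyConstant f)
    (hfc : HasCompactSupport f) {U : Set (ι → F)} (hU : IsOpen U) (hfU : ∀ z : Z, f z ≠ 0 → (z : ι → F) ∈ U) :
    ∃ Φ ∈ SchwartzBruhat (ι → F), (∀ x, Φ x ≠ 0 → x ∈ U) ∧ ∀ z : Z, Φ z = f z := by
  obtain ⟨Φ, hl, hc, hU', hZ⟩ := exists_extension_pi f hfl hfc hU hfU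
  exact ⟨Φ, ⟨hl, hc⟩, hU', hZ⟩

/-- **RESTRICTION `𝒮(F^ι) → 𝒮(Z)` IS ONTO** for `Z` closed (the `U = univ` case). [BernsteinZelevinsky1976, §1.3, Prop. 1.8] -/
theorem exists_schwartzBruhat_comp_val_eq_pi {Z : Set (ι → F)} (f : SchwartzBruhat Z) :
    ∃ Φ : SchwartzBruhat (ι → F), ((Φ : (ι → F) → ℂ) ∘ ((↑) : Z → ι → F)) = f := by
  obtain ⟨Φ, hΦ, -, hZ⟩ := exists_schwartzBruhat_extension_pi (f : Z → ℂ) f.2.1 f.2.2 isOpen_univ fun z _ => mem_univ _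
  exact ⟨⟨Φ, hΦ⟩, funext hZ⟩

end Pi

/-! ## §5  Descent of a functional through the restriction -/

/-- **DESCENT.**  `X` Hausdorff with a basis of compact open sets; `C ⊆ X` closed, `U ⊆ X` open; `T : (X → ℂ) →ₗ[ℂ] ℂ` linear such
that for `Φ, Φ′ ∈ 𝒮(X)` supported in `U` and agreeing on `C ∩ U`, `T Φ = T Φ′`.  Then `T` DESCENDS: there is a linear
`T′ : 𝒮(C ∩ U) →ₗ[ℂ] ℂ` with `T′ f = T Φ` whenever `Φ ∈ 𝒮(X)` is supported in `U` and restricts to `f`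
(V5: `C = 𝒩`, `U = {x ≠ 0}`; the agreement hypothesis is V2b `apply_eq_of_eqOn_nullCone_fun`). [BernsteinZelevinsky1976, §1.8] -/
theorem exists_descend [T2Space X] (hB : IsTopologicalBasis {s : Set X | IsCompact s ∧ IsOpen s}) {C U : Set X} (hU : IsOpen U)
    (T : (X → ℂ) →ₗ[ℂ] ℂ)
    (hT : ∀ Φ Φ' : X → ℂ, Φ ∈ SchwartzBruhat X → Φ' ∈ SchwartzBruhat X → (∀ x, Φ x ≠ 0 → x ∈ U) → (∀ x, Φ' x ≠ 0 → x ∈ U) →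
      (∀ z : ↥(C ∩ U), Φ z = Φ' z) → T Φ = T Φ') :
    ∃ T' : SchwartzBruhat ↥(C ∩ U) →ₗ[ℂ] ℂ, ∀ (f : SchwartzBruhat ↥(C ∩ U)) (Φ : X → ℂ), Φ ∈ SchwartzBruhat X →
      (∀ x, Φ x ≠ 0 → x ∈ U) → (∀ z : ↥(C ∩ U), Φ z = (f : ↥(C ∩ U) → ℂ) z) → T' f = T Φ := by
  -- choose an extension for every `f`
  have hex : ∀ f : SchwartzBruhat ↥(C ∩ U), ∃ Φ : X → ℂ, Φ ∈ SchwartzBruhat X ∧ (∀ x, Φ x ≠ 0 → x ∈ U) ∧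
      ∀ z : ↥(C ∩ U), Φ z = (f : ↥(C ∩ U) → ℂ) z := fun f => by
    obtain ⟨Φ, hΦ, hU', hZ⟩ := exists_schwartzBruhat_extension hB (f : ↥(C ∩ U) → ℂ) f.2.1 f.2.2 hU fun z _ => z.2.2
    exact ⟨Φ, hΦ, hU', hZ⟩
  choose E hE hEU hEZ using hex
  refine ⟨{ toFun := fun f => T (E f), map_add' := fun f g => ?_, map_smul' := fun c f => ?_ }, fun f Φ hΦ hΦU hΦZ => ?_⟩
  · rw [← map_add]
    refine hT _ _ (hE _) (Submodule.add_mem _ (hE f) (hE g)) (hEU _) (fun x hx => ?_) fun z => ?_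
    · by_contra h
      have hf : E f x = 0 := by
        by_contra h'
        exact h (hEU f x h')
      have hg : E g x = 0 := by
        by_contra h'
        exact h (hEU g x h')
      exact hx (by rw [Pi.add_apply, hf, hg, add_zero])
    · rw [hEZ, Pi.add_apply, hEZ, hEZ]
      rfl
  · rw [RingHom.id_apply, ← map_smul]
    refine hT _ _ (hE _) (Submodule.smul_mem _ c (hE f)) (hEU _) (fun x hx => ?_) fun z => ?_
    · by_contra h
      have hf : E f x = 0 := by
        by_contra h'
        exact h (hEU f x h')
      exact hx (by rw [Pi.smul_apply, hf, smul_zero])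
    · rw [hEZ, Pi.smul_apply, hEZ]
      rfl
  · exact hT _ _ (hE f) hΦ (hEU f) hΦU fun z => by rw [hEZ, hΦZ]

/-! ## §6  V5's extension hypothesis `hext` VERBATIM (★ `K2LiuNullConeMultiplicityOne.exists_forall_apply_eq_const_mul_of_nullCone`):
extension off the vertex `o`, vanishing NEAR `o` -/

/-- **V5's `hext` (generic).**  `X` Hausdorff with a basis of compact open sets, `o : X`, `N ⊆ X` any subset: every locally constant compactly
supported `f` on the subspace `N ∖ {o}` is the restriction of a locally constant compactly supported `Φ : X → ℂ` that VANISHES NEAR `o`.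
[BernsteinZelevinsky1976, §1.3, Prop. 1.8] -/
theorem exists_extension_eventually_eq_zero [T2Space X] (hB : IsTopologicalBasis {s : Set X | IsCompact s ∧ IsOpen s}) (o : X) {N : Set X}
    (f : ↥(N ∩ {x : X | x ≠ o}) → ℂ) (hfl : IsLocallyConstant f) (hfc : HasCompactSupport f) :
    ∃ Φ : X → ℂ, IsLocallyConstant Φ ∧ HasCompactSupport Φ ∧ (∀ᶠ x in 𝓝 o, Φ x = 0) ∧ ∀ z : ↥(N ∩ {x : X | x ≠ o}), Φ z = f z := by
  obtain ⟨Φ, hl, hc, hU, hZ⟩ := exists_extension hB f hfl hfc isOpen_ne fun z _ => z.2.2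
  refine ⟨Φ, hl, hc, ?_, hZ⟩
  have h0 : Φ o = 0 := by
    by_contra h
    exact hU o h rfl
  filter_upwards [(hl.isOpen_fiber (Φ o)).mem_nhds rfl] with x hx
  rw [hx, h0]

section PiVertex

variable {F : Type*} [Field F] [ValuativeRel F] [TopologicalSpace F] [IsNonarchimedeanLocalField F]
variable {ι : Type*} [Fintype ι]

/-- **V5's `hext` ON `F^ι` (no hypotheses)** — the instance V5-inst feeds at `X = X_{Δ,B} ≅ F_v^ι`, `o = 0`, `N` = the null cone.
[BernsteinZelevinsky1976, §1.3, Prop. 1.8] -/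
theorem exists_extension_eventually_eq_zero_pi (o : ι → F) {N : Set (ι → F)} (f : ↥(N ∩ {x : ι → F | x ≠ o}) → ℂ)
    (hfl : IsLocallyConstant f) (hfc : HasCompactSupport f) :
    ∃ Φ : (ι → F) → ℂ, IsLocallyConstant Φ ∧ HasCompactSupport Φ ∧ (∀ᶠ x in 𝓝 o, Φ x = 0) ∧
      ∀ z : ↥(N ∩ {x : ι → F | x ≠ o}), Φ z = f z := by
  haveI := t2Space_pi (F := F) (ι := ι)
  exact exists_extension_eventually_eq_zero isTopologicalBasis_isCompact_isOpen_pi o f hfl hfc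

end PiVertex

end Summit.HodgeConjecture.HodgeConjecture.Cruxes.HLiu418.K2LiuTDRestrictionOnto

end
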